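import Summits.Langlands.Langlands.Theses.EisensteinDegreeShift
import Summits.Langlands.Langlands.Theorems.EisensteinDegreeShiftEisensteinSteinbergSeedStubChebotarevUnipotentPlace
import Literature.NumberTheory.GaloisRepresentations.SteinbergShapedPlace

/-!
# BIRTH SKELETON (BC3) — crux stmt-Langlands-18370 `EisensteinDegreeShift.EisensteinSteinbergSeed`
(route `route-Langlands-EisensteinDegreeShift`, rank 3 — "Eisenstein level-raising / Steinberg seed"),
line `birth`, TYPED.

Registered by `planner-skel-stmt-Langlands-18370-0` (skeleton registrar, 2026-08-17).  Three NAMED stubs,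
the kernel-checked composition `EisensteinSteinbergSeed_of : EisensteinSteinbergSeed` (BY NAME — no
hypotheses, the stubs used by name in its body: the shape `#h21_check_skeleton` registers) and, as an
`example`, the same composition in hypothetical form
`<stub₁-sig> → <stub₂-sig> → <stub₃-sig> → EisensteinSteinbergSeed` (sorry-free pure logic), plus an
`Iff.rfl` read-back of the crux text the stubs were cut from.

## The crux

`K` CM, `2 ≤ n < p`, `p` unramified in `K`, `O` the valuation ring of `ℚ̄_p`, `ι : ℚ̄_p ≃ ℂ`;
`ρ : Γ_K → GL_n(ℚ̄_p)` irreducible, a.e. unramified, with a residually upper-triangular integral model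
`ρ₀ : Γ_K → GL_n(O)` ("Borel sector") and crystalline with `τ`-labelled Hodge–Tate weights distinct, `n` of
them, in an interval of length `≤ p − 2` at every `v ∣ p` ("FL sector") ⟹ over some finite SOLVABLE Galois CM
extension `K'/K` (with `p` still unramified and `ρ|_{K'}` still in the sector, integral model `ρ₀'`) there are
a place `v₀ ∤ p` of `K'` (unramified for `ρ|_{K'}`) and a cuspidal L-algebraic `π₀` of `GL_n(𝔸_{K'})` with an
IRREDUCIBLE Galois frame `ρ₁` (Satake-compatible a.e. via `ι`), a residually upper-triangular integral model
`ρ₁₀` whose residual diagonal characters are those of `ρ₀'`, crystalline with the SAME labelled weights as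
`ρ|_{K'}` at every `v ∣ p`, and whose Weil–Deligne representation at `v₀` has `N^{n−1} ≠ 0` (one Jordan
block: the Taylor–Yoshida / "Steinberg" anchor the route's lifting crux `EisensteinSeededLifting` consumes).

## The cut — setup / level-raising / purity (three toolboxes)

* `stub_chebotarevUnipotentPlace` (M-sized, PROVABLE-IN-KIND — Chebotarev): for ANY number field `K`,
  prime `p`, `O` the valuation ring of `ℚ̄_p`, and `ρ` a.e. unramified with a residually upper-triangular
  integral model `ρ₀`, there is a place `v₀ ∤ p`, unramified for `ρ`, with `N v₀ ≡ 1 (mod p)` and ALL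
  residual diagonal characters `χ̄_i = (ρ₀)_{ii} mod 𝔪_O` trivial on the decomposition group
  `Γ_{K_{v₀}} → Γ_K` (`absGaloisRestrict`).  Content: the `χ̄_i` are continuous characters to the discrete
  residue field (`IsResiduallyUpperTriangular.residualDiag_mul`; `𝔪_O` is open), so `H = ⋂ ker χ̄_i ∩ ker ε̄_p`
  is open; Chebotarev in `K̄^H(ζ_p)/K` gives infinitely many `v₀` split completely, and the image of
  `Γ_{K_{v₀}}` is a decomposition group above `v₀` (`DecompositionGroupOfCompletion`), contained in the normal
  subgroup `H`.  This is the "level-raising place" of Ribet / Diamond–Taylor / Taylor's Ihara avoidance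
  (`q ≡ 1 mod p`, `ρ̄|_{D_{v₀}}` unipotent up to semisimplification), i.e. exactly the residual shadow of a
  Steinberg-shaped lift at `v₀`.
* `stub_eisensteinLevelRaising` (OPEN — the crux's LEVER, "Eisenstein / boundary level raising in the weight
  of `ρ`"): all the crux hypotheses PLUS such a place `v₀` ⟹ the crux conclusion with the seed `(π₀, ρ₁, ρ₁₀)`
  required to be STEINBERG-SHAPED UP TO SEMISIMPLIFICATION at the chosen place `w₀ ∤ p` of `K'`
  (`FramedGaloisRep.IsSteinbergShapedSSAt`, hypothesis (v) of Allen–Newton–Thorne: `ρ₁|^{ss}_{Γ_{K'_{w₀}}} ≅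
  ⊕ ψ ε^{n−i}`), congruent to `ρ₀'` on the residual diagonal, crystalline of the same labelled weights, with a
  Borel integral model — but with NEITHER `ρ₁` irreducible NOR the monodromy statement `N^{n−1} ≠ 0`.  This
  is the automorphic existence problem (a cuspidal level-raised congruence to the Eisenstein / boundary
  system in the FL weight, after a solvable CM base change), the analogue for `GL_n` over CM fields of
  Ribet 1976 / Skinner–Wiles §2–3 (`n = 2`) and of the `q ≡ 1 (mod p)` level-raising of Diamond–Taylor /
  Taylor 2008 / Thorne; no theorem in print produces it for residually REDUCIBLE `ρ̄` on `GL_n`, `n ≥ 3`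
  (Allen–Newton–Thorne ASSUME the Steinberg place).  TRUE in expectation (reciprocity + existence of
  crystalline-Steinberg lifts on every component of the global deformation ring after solvable base change).
* `stub_steinbergSeedPurity` (OPEN off the polarizable case — a DIFFERENT toolbox: local–global compatibility
  at `ℓ ≠ p` with monodromy, and irreducibility): `K` CM, `2 ≤ n`, `π` cuspidal L-algebraic on `GL_n(𝔸_K)`
  with a Galois frame `ρ₁` (Satake-compatible a.e.), crystalline with REGULAR labelled weights at every
  `v ∣ p`, Steinberg-shaped up to semisimplification at some `w₀ ∤ p` ⟹ `ρ₁` is IRREDUCIBLE and its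
  Weil–Deligne representation at `w₀` has `N^{n−1} ≠ 0`.  In print for conjugate-self-dual `π`
  (Taylor–Yoshida 2007 Thm B + Cor.; Caraiani 2012 Thm 1.1); OPEN for general (non-polarizable) regular
  algebraic `π` over CM fields — precisely the catalogued barrier
  `Literature.Barriers.Langlands.MonodromyNotClosedUnderPadicLimits` (the `p`-adic interpolation
  constructions of HLTT/Scholze/Varma give `WD(ρ_π|_w)^{ss}` but not `N`), which this stub must beat by a
  non-interpolative input (e.g. the Steinberg-at-`w₀` rigidity of the local deformation ring plus purity of
  the unipotent nearby cycles on a unitary Shimura variety after quadratic base change, or irreducibility via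
  potential automorphy of `∧^i ρ₁`).

Why no stub is the crux or the summit in costume: stub 1 is set-up data (no automorphic object); stub 2
delivers a seed that is only Steinberg-SHAPED-up-to-ss and possibly REDUCIBLE — the crux demands `ρ₁`
irreducible with full monodromy, and passing from "shape of the semisimplification" to "`N^{n−1} ≠ 0` and
irreducible" is the named open purity/irreducibility problem of stub 3, not a cheap step; stub 3 has no
existence content at all (it is a property of a GIVEN automorphic Galois representation).  None of the three
mentions `ReciprocityData`, `Corresponds` or `GlobalLanglandsCorrespondenceGLn`, so none gives `Langlands`.
The BC3 probes `stub → EisensteinSteinbergSeed` / `stub → Langlands` by `first | exact? | simpa | aesop`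
all FAIL (registrar's `bc/` probe files and NOTES.md; summary in `Lines/birth.md`).

Disproof used: none — no `Disproof.lean` exists on this crux at registration time (`ledger crux ls
stmt-Langlands-18370`: no workfiles before this one).  Dead lines: none recorded (`ledger negatives
--problem Langlands` has no statement about Steinberg seeds / level raising).  Barriers (route header):
`MonodromyNotClosedUnderPadicLimits` — isolated in stub 3 and named there; `ResiduallyReducibleLocus` /
Skinner–Wiles-type obstructions — the residual representation is never assumed irreducible anywhere, the
lever (stub 2) is stated for the Borel sector as the route intends; Taylor–Wiles numerical coincidence —
not touched here (it lives in the sibling crux `EisensteinSeededLifting`).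

Leans on (by name): `Summit.Langlands.Langlands.Theses.EisensteinDegreeShift.EisensteinSteinbergSeed` (the
crux), `Literature.NumberTheory.GaloisRepresentations.FramedGaloisRep` (`IsUnramifiedAt`,
`HasUpperTriangularIntegralModel`, `toGaloisRep.IsIrreducible`, `restrictField`, `toLocal`,
`labelledHodgeTateWeightsAt`, `IsSteinbergShapedSSAt`), `…GaloisRepresentations.residualDiag`,
`…GaloisRepresentations.absGaloisRestrict`, `IsDedekindDomain.HeightOneSpectrum.residueCard`,
`Literature.NumberTheory.PAdicHodge.fontainePstAdicCompletion` (`IsCrystallineFramed`, `algebra`, `𝔅`),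
`Literature.NumberTheory.GaloisRepresentations.WeilDeligneRep`, `…IsWeilDeligneOfLadic`,
`Literature.NumberTheory.Automorphic.CuspidalAutomorphicRepData`, `…isCompact_glFiniteIntegralLevel`,
`Summit.Langlands.SatakeFrobCompatibleAt`, `NumberField.IsCMField`, `PadicAlgCl`, `Valued.v`.
-/

noncomputable section

open scoped MatrixGroups NumberField
open Filter

-- `Summit.Langlands.Langlands.…`: summit = sub-problem name (D-0017 nested layout), not a typo.
set_option linter.dupNamespace false

namespace Summit.Langlands.Langlands.Cruxes.EisensteinSteinbergSeed.Birth

-- STUB 1 `stub_chebotarevUnipotentPlace`: LANDED (p173405, commit 681a58d7ca2e) in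
-- `Summits/Langlands/Langlands/Theorems/EisensteinDegreeShiftEisensteinSteinbergSeedStubChebotarevUnipotentPlace.lean`,
-- same namespace, imported above and used by name in `EisensteinSteinbergSeed_of`.

/-- **STUB 2 — `EisensteinLevelRaising` (the crux's lever: a cuspidal, Steinberg-shaped, same-weight
crystalline congruence to the Eisenstein datum `ρ̄^{ss} = ⊕ χ̄_i`, after a solvable CM base change).**
All the hypotheses of the crux (`K` CM, `2 ≤ n < p`, `p` unramified, `O`, `ι`, `ρ` irreducible a.e.
unramified in the Borel ∩ Fontaine–Laffaille sector with integral model `ρ₀`) PLUS a place `v₀ ∤ p` as in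
stub 1 ⟹ a finite solvable Galois CM extension `K'/K` with `p` unramified, `ρ|_{K'}` still in the sector
(integral model `ρ₀'`), a place `w₀ ∤ p` of `K'` unramified for `ρ|_{K'}`, and a cuspidal L-algebraic `π₀` on
`GL_n(𝔸_{K'})` with a Galois frame `ρ₁` (Satake-compatible a.e. via `ι`), a residually upper-triangular
integral model `ρ₁₀` with `(ρ₁₀)_{ii} ≡ (ρ₀')_{ii} (mod 𝔪_O)` on `Γ_{K'}`, crystalline with the same labelled
Hodge–Tate weights as `ρ|_{K'}` at every `v ∣ p`, and STEINBERG-SHAPED UP TO SEMISIMPLIFICATION at `w₀`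
(`IsSteinbergShapedSSAt`).  No irreducibility of `ρ₁`, no monodromy.  Eisenstein-ideal / boundary-cohomology
level raising for `GL_n` over CM fields in the weight of `ρ`; OPEN (`n = 2`: Ribet, Skinner–Wiles §2–§3).
[cite: Ribet1976] [cite: SkinnerWiles1999, §2–§3] [cite: DiamondTaylor1994] [cite: Taylor2008]
[cite: AllenNewtonThorne2020, Thm 1.1 (v)] [cite: NewtonThorne2016] -/
theorem stub_eisensteinLevelRaising :
    ∀ (K : Type) [Field K] [NumberField K], NumberField.IsCMField K → ∀ (n : ℕ), 2 ≤ n → ∀ (p : ℕ) [Fact p.Prime], n < p → (∀ v : IsDedekindDomain.HeightOneSpectrum ((NumberField.RingOfIntegers K)), ((p : ℕ) : (NumberField.RingOfIntegers K)) ∈ v.asIdeal → ¬ v.asIdeal ^ 2 ∣ Ideal.span {((p : ℕ) : (NumberField.RingOfIntegers K))}) → ∀ (O : ValuationSubring (PadicAlgCl p)), O = (Valued.v : Valuation (PadicAlgCl p) NNReal).valuationSubring → ∀ (ι : PadicAlgCl p ≃+* ℂ) (ρ : Literature.NumberTheory.GaloisRepresentations.FramedGaloisRep K (PadicAlgCl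 p) n) (ρ₀ : Field.absoluteGaloisGroup K →* GL (Fin n) O), ρ.toGaloisRep.IsIrreducible → (∀ᶠ v : IsDedekindDomain.HeightOneSpectrum ((NumberField.RingOfIntegers K)) in Filter.cofinite, ρ.IsUnramifiedAt v) → ρ.HasUpperTriangularIntegralModel ρ₀ → (∀ (v : IsDedekindDomain.HeightOneSpectrum ((NumberField.RingOfIntegers K))) (hv : ((p : ℕ) : (NumberField.RingOfIntegers K)) ∈ v.asIdeal), let D := Literature.NumberTheory.PAdicHodge.fontainePstAdicCompletion v p hv; D.IsCrystallineFramed (ρ.toLocal v) ∧ (letI := D.algebra; ∀ τ : v.adicCompletion K →ₐ[ℚ_[p]] PadicAlgCl p, let M := ρ.labelledHodgeTateWeightsAt v D.algebra D.𝔅 τ.toRingHom; M.Nodup ∧ Multiset.card M = n ∧ ∀ a ∈ M, ∀ b ∈ M, a - b ≤ (p : ℤ) - 2)) → ∀ (v₀ : IsDedekindDomain.HeightOneSpectrum ((NumberField.RingOfIntegers K))), ((p : ℕ) : (NumberField.RingOfIntegers K)) ∉ v₀.asIdeal → ρ.IsUnramifiedAt v₀ → Nat.ModEq p v₀.residueCard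 1 → (∀ (σ : Field.absoluteGaloisGroup (v₀.adicCompletion K)) (i : Fin n), Literature.NumberTheory.GaloisRepresentations.residualDiag ρ₀ i (Literature.NumberTheory.GaloisRepresentations.absGaloisRestrict K (v₀.adicCompletion K) σ) = 1) → ∃ (K' : Type) (_ : Field K') (_ : NumberField K') (_ : Algebra K K'), IsGalois K K' ∧ IsSolvable (K' ≃ₐ[K] K') ∧ NumberField.IsCMField K' ∧ (∀ w : IsDedekindDomain.HeightOneSpectrum ((NumberField.RingOfIntegers K')), ((p : ℕ) : (NumberField.RingOfIntegers K')) ∈ w.asIdeal → ¬ w.asIdeal ^ 2 ∣ Ideal.span {((p : ℕ) : (NumberField.RingOfIntegers K'))}) ∧ ∃ (ρ₀' : Field.absoluteGaloisGroup K' →* GL (Fin n) O), (ρ.restrictField K').toGaloisRep.IsIrreducible ∧ (∀ᶠ v : IsDedekindDomain.HeightOneSpectrum ((NumberField.RingOfIntegers K')) in Filter.cofinite, (ρ.restrictField K').IsUnramifiedAt v) ∧ (ρ.restrictField K').HasUpperTriangularIntegralModel ρ₀' ∧ (∀ (v : IsDedekindDomain.HeightOneSpectrum ((NumberField.RingOfIntegers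 K'))) (hv : ((p : ℕ) : (NumberField.RingOfIntegers K')) ∈ v.asIdeal), let D := Literature.NumberTheory.PAdicHodge.fontainePstAdicCompletion v p hv; D.IsCrystallineFramed ((ρ.restrictField K').toLocal v) ∧ (letI := D.algebra; ∀ τ : v.adicCompletion K' →ₐ[ℚ_[p]] PadicAlgCl p, let M := (ρ.restrictField K').labelledHodgeTateWeightsAt v D.algebra D.𝔅 τ.toRingHom; M.Nodup ∧ Multiset.card M = n ∧ ∀ a ∈ M, ∀ b ∈ M, a - b ≤ (p : ℤ) - 2)) ∧ ∃ w₀ : IsDedekindDomain.HeightOneSpectrum ((NumberField.RingOfIntegers K')), ((p : ℕ) : (NumberField.RingOfIntegers K')) ∉ w₀.asIdeal ∧ (ρ.restrictField K').IsUnramifiedAt w₀ ∧ ∃ (hcpt' : Literature.NumberTheory.Automorphic.isCompact_glFiniteIntegralLevel n K') (π₀ : Literature.NumberTheory.Automorphic.CuspidalAutomorphicRepData n K' hcpt') (ρ₁ : Literature.NumberTheory.GaloisRepresentations.FramedGaloisRep K' (PadicAlgCl p) n) (ρ₁₀ : Field.absoluteGaloisGroup K' →* GL (Fin n) O), π₀.1.IsLAlgebraic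 ∧ (∀ᶠ v : IsDedekindDomain.HeightOneSpectrum ((NumberField.RingOfIntegers K')) in Filter.cofinite, Summit.Langlands.SatakeFrobCompatibleAt ι π₀.1 ρ₁ v) ∧ ρ₁.HasUpperTriangularIntegralModel ρ₁₀ ∧ (∀ (g : Field.absoluteGaloisGroup K') (i : Fin n), (((ρ₁₀ g).val i i - (ρ₀' g).val i i : O)) ∈ IsLocalRing.maximalIdeal O) ∧ (∀ (v : IsDedekindDomain.HeightOneSpectrum ((NumberField.RingOfIntegers K'))) (hv : ((p : ℕ) : (NumberField.RingOfIntegers K')) ∈ v.asIdeal), let D := Literature.NumberTheory.PAdicHodge.fontainePstAdicCompletion v p hv; D.IsCrystallineFramed (ρ₁.toLocal v) ∧ (letI := D.algebra; ∀ τ : v.adicCompletion K' →ₐ[ℚ_[p]] PadicAlgCl p, ρ₁.labelledHodgeTateWeightsAt v D.algebra D.𝔅 τ.toRingHom = (ρ.restrictField K').labelledHodgeTateWeightsAt v D.algebra D.𝔅 τ.toRingHom)) ∧ ρ₁.IsSteinbergShapedSSAt w₀ := by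
  sorry

/-- **STUB 3 — `SteinbergSeedPurity` (irreducibility and full monodromy of a Steinberg-shaped automorphic
Galois representation — local–global compatibility at `ℓ ≠ p` WITH `N`).**  `K` CM, `2 ≤ n`, `π` cuspidal
L-algebraic on `GL_n(𝔸_K)` with a Galois frame `ρ₁ : Γ_K → GL_n(ℚ̄_p)` (Satake-compatible a.e. via `ι`),
crystalline with regular (`Nodup`, `n` of them) labelled Hodge–Tate weights at every `v ∣ p`, and
Steinberg-shaped up to semisimplification at a place `w₀ ∤ p` ⟹ `ρ₁` is irreducible and admits a Weil–Deligne
representation at `w₀` with `N^{n−1} ≠ 0`.  In print for conjugate-self-dual `π` (Taylor–Yoshida; Caraiani);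
OPEN in the non-polarizable case — the catalogued barrier `MonodromyNotClosedUnderPadicLimits` is exactly
the statement that the known constructions of `ρ_π` there do not see `N`.
[cite: TaylorYoshida2007, Thm B] [cite: Caraiani2012, Thm 1.1] [cite: HarrisLanTaylorThorneRMS2016]
[cite: Scholze2015] [cite: AllenCalegariCaraianiGeeEtAl2023] -/
theorem stub_steinbergSeedPurity :
    ∀ (K : Type) [Field K] [NumberField K], NumberField.IsCMField K → ∀ (n : ℕ), 2 ≤ n → ∀ (p : ℕ) [Fact p.Prime] (hcpt : Literature.NumberTheory.Automorphic.isCompact_glFiniteIntegralLevel n K) (ι : PadicAlgCl p ≃+* ℂ) (π : Literature.NumberTheory.Automorphic.CuspidalAutomorphicRepData n K hcpt) (ρ₁ : Literature.NumberTheory.GaloisRepresentations.FramedGaloisRep K (PadicAlgCl p) n), π.1.IsLAlgebraic → (∀ᶠ v : IsDedekindDomain.HeightOneSpectrum ((NumberField.RingOfIntegers K)) in Filter.cofinite, Summit.Langlands.SatakeFrobCompatibleAt ι π.1 ρ₁ v) → (∀ (v : IsDedekindDomain.HeightOneSpectrum ((NumberField.RingOfIntegers K))) (hv : ((p : ℕ)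 : (NumberField.RingOfIntegers K)) ∈ v.asIdeal), let D := Literature.NumberTheory.PAdicHodge.fontainePstAdicCompletion v p hv; D.IsCrystallineFramed (ρ₁.toLocal v) ∧ (letI := D.algebra; ∀ τ : v.adicCompletion K →ₐ[ℚ_[p]] PadicAlgCl p, let M := ρ₁.labelledHodgeTateWeightsAt v D.algebra D.𝔅 τ.toRingHom; M.Nodup ∧ Multiset.card M = n)) → ∀ (w₀ : IsDedekindDomain.HeightOneSpectrum ((NumberField.RingOfIntegers K))), ((p : ℕ) : (NumberField.RingOfIntegers K)) ∉ w₀.asIdeal → ρ₁.IsSteinbergShapedSSAt w₀ → ρ₁.toGaloisRep.IsIrreducible ∧ ∃ r : Literature.NumberTheory.GaloisRepresentations.WeilDeligneRep (w₀.adicCompletion K) (PadicAlgCl p) (Fin n → PadicAlgCl p), Literature.NumberTheory.GaloisRepresentations.IsWeilDeligneOfLadic (ρ₁.toLocal w₀).toWeilGroupHom r ∧ r.N ^ (n - 1) ≠ 0 := by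
  sorry

/-- **The crux BY NAME from the three stubs** (the registered skeleton theorem: no hypotheses, the declared
stubs used by name in the body).  Fix the crux binders; stub 1 gives the level-raising place `v₀`; stub 2 gives
`K'`, the sector data for `ρ|_{K'}`, the place `w₀` and the Steinberg-shaped seed `(π₀, ρ₁, ρ₁₀)`; the
regularity of `ρ₁`'s labelled weights is read off the "same weights as `ρ|_{K'}`" clause and the FL clause for
`ρ|_{K'}`; stub 3 then gives `ρ₁` irreducible and `N^{n−1} ≠ 0` at `w₀`; reassemble the crux tuple. [folklore] -/
theorem EisensteinSteinbergSeed_of :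
    Summit.Langlands.Langlands.Theses.EisensteinDegreeShift.EisensteinSteinbergSeed := by
  intro K _ _ hK n hn p _ hp hur O hO ι ρ ρ₀ hirr hae hut hFL
  obtain ⟨v₀, hv₀p, hunr₀, hq, htriv⟩ := stub_chebotarevUnipotentPlace K n p O hO ρ ρ₀ hae hut
  obtain ⟨K', iF, iN, iA, hgal, hsol, hK', hur', ρ₀', hirr', hae', hut', hFL', w₀, hw₀p, hunr', hcpt', π₀, ρ₁,
      ρ₁₀, hLalg, hSat, hut₁, hdiag, hcrys, hSt⟩ :=
    stub_eisensteinLevelRaising K hK n hn p hp hur O hO ι ρ ρ₀ hirr hae hut hFL v₀ hv₀p hunr₀ hq htriv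
  have hreg : ∀ (v : IsDedekindDomain.HeightOneSpectrum ((NumberField.RingOfIntegers K')))
      (hv : ((p : ℕ) : (NumberField.RingOfIntegers K')) ∈ v.asIdeal),
      let D := Literature.NumberTheory.PAdicHodge.fontainePstAdicCompletion v p hv;
      D.IsCrystallineFramed (ρ₁.toLocal v) ∧ (letI := D.algebra;
        ∀ τ : v.adicCompletion K' →ₐ[ℚ_[p]] PadicAlgCl p,
          let M := ρ₁.labelledHodgeTateWeightsAt v D.algebra D.𝔅 τ.toRingHom;
          M.Nodup ∧ Multiset.card M = n) := by
    intro v hv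
    refine ⟨(hcrys v hv).1, fun τ => ?_⟩
    have h1 := (hcrys v hv).2 τ
    have h2 := (hFL' v hv).2 τ
    simp only [] at h1 h2 ⊢
    rw [h1]
    exact ⟨h2.1, h2.2.1⟩
  obtain ⟨hirr₁, r, hr, hN⟩ :=
    stub_steinbergSeedPurity K' hK' n hn p hcpt' ι π₀ ρ₁ hLalg hSat hreg w₀ hw₀p hSt
  exact ⟨K', iF, iN, iA, hgal, hsol, hK', hur', ρ₀', hirr', hae', hut', hFL', w₀, hw₀p, hunr', hcpt', π₀, ρ₁,
    ρ₁₀, hLalg, hSat, hirr₁, hut₁, hdiag, hcrys, r, hr, hN⟩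

/-- **The same composition as PURE LOGIC, hypothetical form**
`<stub₁-sig> → <stub₂-sig> → <stub₃-sig> → EisensteinSteinbergSeed` (sorry-free and axiom-clean: the real
proof that the three stub statements imply the crux; an `example`, so that the skeleton audit sees exactly
one theorem concluding the crux). [folklore] -/
example :
    (∀ (K : Type) [Field K] [NumberField K] (n : ℕ) (p : ℕ) [Fact p.Prime] (O : ValuationSubring (PadicAlgCl p)), O = (Valued.v : Valuation (PadicAlgCl p) NNReal).valuationSubring → ∀ (ρ : Literature.NumberTheory.GaloisRepresentations.FramedGaloisRep K (PadicAlgCl p) n) (ρ₀ : Field.absoluteGaloisGroup K →* GL (Fin n) O), (∀ᶠ v : IsDedekindDomain.HeightOneSpectrum ((NumberField.RingOfIntegers K)) in Filter.cofinite, ρ.IsUnramifiedAt v) → ρ.HasUpperTriangularIntegralModel ρ₀ → ∃ v₀ : IsDedekindDomain.HeightOneSpectrum ((NumberField.RingOfIntegers K)), ((p : ℕ) : (NumberField.RingOfIntegers K)) ∉ v₀.asIdeal ∧ ρ.IsUnramifiedAt v₀ ∧ Nat.ModEq p v₀.residueCard 1 ∧ ∀ (σ : Field.absoluteGaloisGroup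 (v₀.adicCompletion K)) (i : Fin n), Literature.NumberTheory.GaloisRepresentations.residualDiag ρ₀ i (Literature.NumberTheory.GaloisRepresentations.absGaloisRestrict K (v₀.adicCompletion K) σ) = 1) →
    (∀ (K : Type) [Field K] [NumberField K], NumberField.IsCMField K → ∀ (n : ℕ), 2 ≤ n → ∀ (p : ℕ) [Fact p.Prime], n < p → (∀ v : IsDedekindDomain.HeightOneSpectrum ((NumberField.RingOfIntegers K)), ((p : ℕ) : (NumberField.RingOfIntegers K)) ∈ v.asIdeal → ¬ v.asIdeal ^ 2 ∣ Ideal.span {((p : ℕ) : (NumberField.RingOfIntegers K))}) → ∀ (O : ValuationSubring (PadicAlgCl p)), O = (Valued.v : Valuation (PadicAlgCl p) NNReal).valuationSubring → ∀ (ι : PadicAlgCl p ≃+* ℂ) (ρ : Literature.NumberTheory.GaloisRepresentations.FramedGaloisRep K (PadicAlgCl p) n) (ρ₀ : Field.absoluteGaloisGroup K →* GL (Fin n) O), ρ.toGaloisRep.IsIrreducible → (∀ᶠ v : IsDedekindDomain.HeightOneSpectrum ((NumberField.RingOfIntegers K)) in Filter.cofinite, ρ.IsUnramifiedAt v) → ρ.HasUpperTriangularIntegralModel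 ρ₀ → (∀ (v : IsDedekindDomain.HeightOneSpectrum ((NumberField.RingOfIntegers K))) (hv : ((p : ℕ) : (NumberField.RingOfIntegers K)) ∈ v.asIdeal), let D := Literature.NumberTheory.PAdicHodge.fontainePstAdicCompletion v p hv; D.IsCrystallineFramed (ρ.toLocal v) ∧ (letI := D.algebra; ∀ τ : v.adicCompletion K →ₐ[ℚ_[p]] PadicAlgCl p, let M := ρ.labelledHodgeTateWeightsAt v D.algebra D.𝔅 τ.toRingHom; M.Nodup ∧ Multiset.card M = n ∧ ∀ a ∈ M, ∀ b ∈ M, a - b ≤ (p : ℤ) - 2)) → ∀ (v₀ : IsDedekindDomain.HeightOneSpectrum ((NumberField.RingOfIntegers K))), ((p : ℕ) : (NumberField.RingOfIntegers K)) ∉ v₀.asIdeal → ρ.IsUnramifiedAt v₀ → Nat.ModEq p v₀.residueCard 1 → (∀ (σ : Field.absoluteGaloisGroup (v₀.adicCompletion K)) (i : Fin n), Literature.NumberTheory.GaloisRepresentations.residualDiag ρ₀ i (Literature.NumberTheory.GaloisRepresentations.absGaloisRestrict K (v₀.adicCompletion K) σ) = 1) → ∃ (K' : Type) (_ : Field K')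 (_ : NumberField K') (_ : Algebra K K'), IsGalois K K' ∧ IsSolvable (K' ≃ₐ[K] K') ∧ NumberField.IsCMField K' ∧ (∀ w : IsDedekindDomain.HeightOneSpectrum ((NumberField.RingOfIntegers K')), ((p : ℕ) : (NumberField.RingOfIntegers K')) ∈ w.asIdeal → ¬ w.asIdeal ^ 2 ∣ Ideal.span {((p : ℕ) : (NumberField.RingOfIntegers K'))}) ∧ ∃ (ρ₀' : Field.absoluteGaloisGroup K' →* GL (Fin n) O), (ρ.restrictField K').toGaloisRep.IsIrreducible ∧ (∀ᶠ v : IsDedekindDomain.HeightOneSpectrum ((NumberField.RingOfIntegers K')) in Filter.cofinite, (ρ.restrictField K').IsUnramifiedAt v) ∧ (ρ.restrictField K').HasUpperTriangularIntegralModel ρ₀' ∧ (∀ (v : IsDedekindDomain.HeightOneSpectrum ((NumberField.RingOfIntegers K'))) (hv : ((p : ℕ) : (NumberField.RingOfIntegers K')) ∈ v.asIdeal), let D := Literature.NumberTheory.PAdicHodge.fontainePstAdicCompletion v p hv; D.IsCrystallineFramed ((ρ.restrictField K').toLocal v) ∧ (letI := D.algebra; ∀ τ : v.adicCompletion K' →ₐ[ℚ_[p]]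 PadicAlgCl p, let M := (ρ.restrictField K').labelledHodgeTateWeightsAt v D.algebra D.𝔅 τ.toRingHom; M.Nodup ∧ Multiset.card M = n ∧ ∀ a ∈ M, ∀ b ∈ M, a - b ≤ (p : ℤ) - 2)) ∧ ∃ w₀ : IsDedekindDomain.HeightOneSpectrum ((NumberField.RingOfIntegers K')), ((p : ℕ) : (NumberField.RingOfIntegers K')) ∉ w₀.asIdeal ∧ (ρ.restrictField K').IsUnramifiedAt w₀ ∧ ∃ (hcpt' : Literature.NumberTheory.Automorphic.isCompact_glFiniteIntegralLevel n K') (π₀ : Literature.NumberTheory.Automorphic.CuspidalAutomorphicRepData n K' hcpt') (ρ₁ : Literature.NumberTheory.GaloisRepresentations.FramedGaloisRep K' (PadicAlgCl p) n) (ρ₁₀ : Field.absoluteGaloisGroup K' →* GL (Fin n) O), π₀.1.IsLAlgebraic ∧ (∀ᶠ v : IsDedekindDomain.HeightOneSpectrum ((NumberField.RingOfIntegers K')) in Filter.cofinite, Summit.Langlands.SatakeFrobCompatibleAt ι π₀.1 ρ₁ v) ∧ ρ₁.HasUpperTriangularIntegralModel ρ₁₀ ∧ (∀ (g : Field.absoluteGaloisGroup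 K') (i : Fin n), (((ρ₁₀ g).val i i - (ρ₀' g).val i i : O)) ∈ IsLocalRing.maximalIdeal O) ∧ (∀ (v : IsDedekindDomain.HeightOneSpectrum ((NumberField.RingOfIntegers K'))) (hv : ((p : ℕ) : (NumberField.RingOfIntegers K')) ∈ v.asIdeal), let D := Literature.NumberTheory.PAdicHodge.fontainePstAdicCompletion v p hv; D.IsCrystallineFramed (ρ₁.toLocal v) ∧ (letI := D.algebra; ∀ τ : v.adicCompletion K' →ₐ[ℚ_[p]] PadicAlgCl p, ρ₁.labelledHodgeTateWeightsAt v D.algebra D.𝔅 τ.toRingHom = (ρ.restrictField K').labelledHodgeTateWeightsAt v D.algebra D.𝔅 τ.toRingHom)) ∧ ρ₁.IsSteinbergShapedSSAt w₀) →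
    (∀ (K : Type) [Field K] [NumberField K], NumberField.IsCMField K → ∀ (n : ℕ), 2 ≤ n → ∀ (p : ℕ) [Fact p.Prime] (hcpt : Literature.NumberTheory.Automorphic.isCompact_glFiniteIntegralLevel n K) (ι : PadicAlgCl p ≃+* ℂ) (π : Literature.NumberTheory.Automorphic.CuspidalAutomorphicRepData n K hcpt) (ρ₁ : Literature.NumberTheory.GaloisRepresentations.FramedGaloisRep K (PadicAlgCl p) n), π.1.IsLAlgebraic → (∀ᶠ v : IsDedekindDomain.HeightOneSpectrum ((NumberField.RingOfIntegers K)) in Filter.cofinite, Summit.Langlands.SatakeFrobCompatibleAt ι π.1 ρ₁ v) → (∀ (v : IsDedekindDomain.HeightOneSpectrum ((NumberField.RingOfIntegers K))) (hv : ((p : ℕ) : (NumberField.RingOfIntegers K)) ∈ v.asIdeal), let D := Literature.NumberTheory.PAdicHodge.fontainePstAdicCompletion v p hv; D.IsCrystallineFramed (ρ₁.toLocal v) ∧ (letI := D.algebra; ∀ τ : v.adicCompletion K →ₐ[ℚ_[p]] PadicAlgCl p, let M := ρ₁.labelledHodgeTateWeightsAt v D.algebra D.𝔅 τ.toRingHom;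 M.Nodup ∧ Multiset.card M = n)) → ∀ (w₀ : IsDedekindDomain.HeightOneSpectrum ((NumberField.RingOfIntegers K))), ((p : ℕ) : (NumberField.RingOfIntegers K)) ∉ w₀.asIdeal → ρ₁.IsSteinbergShapedSSAt w₀ → ρ₁.toGaloisRep.IsIrreducible ∧ ∃ r : Literature.NumberTheory.GaloisRepresentations.WeilDeligneRep (w₀.adicCompletion K) (PadicAlgCl p) (Fin n → PadicAlgCl p), Literature.NumberTheory.GaloisRepresentations.IsWeilDeligneOfLadic (ρ₁.toLocal w₀).toWeilGroupHom r ∧ r.N ^ (n - 1) ≠ 0) →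
    Summit.Langlands.Langlands.Theses.EisensteinDegreeShift.EisensteinSteinbergSeed := by
  intro h1s h2s h3s K _ _ hK n hn p _ hp hur O hO ι ρ ρ₀ hirr hae hut hFL
  obtain ⟨v₀, hv₀p, hunr₀, hq, htriv⟩ := h1s K n p O hO ρ ρ₀ hae hut
  obtain ⟨K', iF, iN, iA, hgal, hsol, hK', hur', ρ₀', hirr', hae', hut', hFL', w₀, hw₀p, hunr', hcpt', π₀, ρ₁,
      ρ₁₀, hLalg, hSat, hut₁, hdiag, hcrys, hSt⟩ :=
    h2s K hK n hn p hp hur O hO ι ρ ρ₀ hirr hae hut hFL v₀ hv₀p hunr₀ hq htriv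
  have hreg : ∀ (v : IsDedekindDomain.HeightOneSpectrum ((NumberField.RingOfIntegers K')))
      (hv : ((p : ℕ) : (NumberField.RingOfIntegers K')) ∈ v.asIdeal),
      let D := Literature.NumberTheory.PAdicHodge.fontainePstAdicCompletion v p hv;
      D.IsCrystallineFramed (ρ₁.toLocal v) ∧ (letI := D.algebra;
        ∀ τ : v.adicCompletion K' →ₐ[ℚ_[p]] PadicAlgCl p,
          let M := ρ₁.labelledHodgeTateWeightsAt v D.algebra D.𝔅 τ.toRingHom;
          M.Nodup ∧ Multiset.card M = n) := by
    intro v hv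
    refine ⟨(hcrys v hv).1, fun τ => ?_⟩
    have h1 := (hcrys v hv).2 τ
    have h2 := (hFL' v hv).2 τ
    simp only [] at h1 h2 ⊢
    rw [h1]
    exact ⟨h2.1, h2.2.1⟩
  obtain ⟨hirr₁, r, hr, hN⟩ :=
    h3s K' hK' n hn p hcpt' ι π₀ ρ₁ hLalg hSat hreg w₀ hw₀p hSt
  exact ⟨K', iF, iN, iA, hgal, hsol, hK', hur', ρ₀', hirr', hae', hut', hFL', w₀, hw₀p, hunr', hcpt', π₀, ρ₁,
    ρ₁₀, hLalg, hSat, hirr₁, hut₁, hdiag, hcrys, r, hr, hN⟩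

/-- Sanity (read-back): the conclusion of `EisensteinSteinbergSeed_of` is the route decl, and the route decl
unfolds to the verbatim crux text used to cut the stubs. [bookkeeping] -/
example : Summit.Langlands.Langlands.Theses.EisensteinDegreeShift.EisensteinSteinbergSeed ↔
    (∀ (K : Type) [Field K] [NumberField K], NumberField.IsCMField K → ∀ (n : ℕ), 2 ≤ n → ∀ (p : ℕ) [Fact p.Prime], n < p → (∀ v : IsDedekindDomain.HeightOneSpectrum ((NumberField.RingOfIntegers K)), ((p : ℕ) : (NumberField.RingOfIntegers K)) ∈ v.asIdeal → ¬ v.asIdeal ^ 2 ∣ Ideal.span {((p : ℕ) : (NumberField.RingOfIntegers K))}) → ∀ (O : ValuationSubring (PadicAlgCl p)), O = (Valued.v : Valuation (PadicAlgCl p) NNReal).valuationSubring → ∀ (ι : PadicAlgCl p ≃+* ℂ) (ρ : Literature.NumberTheory.GaloisRepresentations.FramedGaloisRep K (PadicAlgCl p) n) (ρ₀ : Field.absoluteGaloisGroup K →* GL (Fin n) O), ρ.toGaloisRep.IsIrreducible → (∀ᶠ v : IsDedekindDomain.HeightOneSpectrum ((NumberField.RingOfIntegers K)) in Filter.cofinite,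 ρ.IsUnramifiedAt v) → ρ.HasUpperTriangularIntegralModel ρ₀ → (∀ (v : IsDedekindDomain.HeightOneSpectrum ((NumberField.RingOfIntegers K))) (hv : ((p : ℕ) : (NumberField.RingOfIntegers K)) ∈ v.asIdeal), let D := Literature.NumberTheory.PAdicHodge.fontainePstAdicCompletion v p hv; D.IsCrystallineFramed (ρ.toLocal v) ∧ (letI := D.algebra; ∀ τ : v.adicCompletion K →ₐ[ℚ_[p]] PadicAlgCl p, let M := ρ.labelledHodgeTateWeightsAt v D.algebra D.𝔅 τ.toRingHom; M.Nodup ∧ Multiset.card M = n ∧ ∀ a ∈ M, ∀ b ∈ M, a - b ≤ (p : ℤ) - 2)) → ∃ (K' : Type) (_ : Field K') (_ : NumberField K') (_ : Algebra K K'), IsGalois K K' ∧ IsSolvable (K' ≃ₐ[K] K') ∧ NumberField.IsCMField K' ∧ (∀ w : IsDedekindDomain.HeightOneSpectrum ((NumberField.RingOfIntegers K')), ((p : ℕ) : (NumberField.RingOfIntegers K')) ∈ w.asIdeal → ¬ w.asIdeal ^ 2 ∣ Ideal.span {((p : ℕ) : (NumberField.RingOfIntegers K'))}) ∧ ∃ (ρ₀'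 : Field.absoluteGaloisGroup K' →* GL (Fin n) O), (ρ.restrictField K').toGaloisRep.IsIrreducible ∧ (∀ᶠ v : IsDedekindDomain.HeightOneSpectrum ((NumberField.RingOfIntegers K')) in Filter.cofinite, (ρ.restrictField K').IsUnramifiedAt v) ∧ (ρ.restrictField K').HasUpperTriangularIntegralModel ρ₀' ∧ (∀ (v : IsDedekindDomain.HeightOneSpectrum ((NumberField.RingOfIntegers K'))) (hv : ((p : ℕ) : (NumberField.RingOfIntegers K')) ∈ v.asIdeal), let D := Literature.NumberTheory.PAdicHodge.fontainePstAdicCompletion v p hv; D.IsCrystallineFramed ((ρ.restrictField K').toLocal v) ∧ (letI := D.algebra; ∀ τ : v.adicCompletion K' →ₐ[ℚ_[p]] PadicAlgCl p, let M := (ρ.restrictField K').labelledHodgeTateWeightsAt v D.algebra D.𝔅 τ.toRingHom; M.Nodup ∧ Multiset.card M = n ∧ ∀ a ∈ M, ∀ b ∈ M, a - b ≤ (p : ℤ) - 2)) ∧ ∃ v₀ : IsDedekindDomain.HeightOneSpectrum ((NumberField.RingOfIntegers K')), ((p : ℕ) : (NumberField.RingOfIntegers K')) ∉ v₀.asIdeal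 ∧ (ρ.restrictField K').IsUnramifiedAt v₀ ∧ ∃ (hcpt' : Literature.NumberTheory.Automorphic.isCompact_glFiniteIntegralLevel n K') (π₀ : Literature.NumberTheory.Automorphic.CuspidalAutomorphicRepData n K' hcpt') (ρ₁ : Literature.NumberTheory.GaloisRepresentations.FramedGaloisRep K' (PadicAlgCl p) n) (ρ₁₀ : Field.absoluteGaloisGroup K' →* GL (Fin n) O), π₀.1.IsLAlgebraic ∧ (∀ᶠ v : IsDedekindDomain.HeightOneSpectrum ((NumberField.RingOfIntegers K')) in Filter.cofinite, Summit.Langlands.SatakeFrobCompatibleAt ι π₀.1 ρ₁ v) ∧ ρ₁.toGaloisRep.IsIrreducible ∧ ρ₁.HasUpperTriangularIntegralModel ρ₁₀ ∧ (∀ (g : Field.absoluteGaloisGroup K') (i : Fin n), (((ρ₁₀ g).val i i - (ρ₀' g).val i i : O)) ∈ IsLocalRing.maximalIdeal O) ∧ (∀ (v : IsDedekindDomain.HeightOneSpectrum ((NumberField.RingOfIntegers K'))) (hv : ((p : ℕ) : (NumberField.RingOfIntegers K')) ∈ v.asIdeal), let D := Literature.NumberTheory.PAdicHodge.fontainePstAdicCompletion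 v p hv; D.IsCrystallineFramed (ρ₁.toLocal v) ∧ (letI := D.algebra; ∀ τ : v.adicCompletion K' →ₐ[ℚ_[p]] PadicAlgCl p, ρ₁.labelledHodgeTateWeightsAt v D.algebra D.𝔅 τ.toRingHom = (ρ.restrictField K').labelledHodgeTateWeightsAt v D.algebra D.𝔅 τ.toRingHom)) ∧ ∃ r : Literature.NumberTheory.GaloisRepresentations.WeilDeligneRep (v₀.adicCompletion K') (PadicAlgCl p) (Fin n → PadicAlgCl p), Literature.NumberTheory.GaloisRepresentations.IsWeilDeligneOfLadic (ρ₁.toLocal v₀).toWeilGroupHom r ∧ r.N ^ (n - 1) ≠ 0) :=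
  Iff.rfl

end Summit.Langlands.Langlands.Cruxes.EisensteinSteinbergSeed.Birth

end
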